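import Mathlib.RingTheory.MvPolynomial.Homogeneous
import Mathlib.RingTheory.Nullstellensatz
import Mathlib.Algebra.MvPolynomial.Funext
import Mathlib.Algebra.MvPolynomial.Division
import Mathlib.LinearAlgebra.Matrix.Adjugate
import Mathlib.RingTheory.Polynomial.UniqueFactorization
import Mathlib.RingTheory.Ideal.Colon
import Mathlib.LinearAlgebra.FiniteDimensional.Lemmas
import Mathlib.LinearAlgebra.Dimension.Constructions
import Literature.AlgebraicGeometry.Resolution.AdicNoetherian
import HarnessLib

/-!
# Kerner–Vinnikov decomposability: algebraic preliminaries (proofs)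

Support lemmas for the proof of `KernerVinnikov2012_globallyDecomposable_iff`
(`KernerVinnikovDecomposability.lean`; D. Kerner, V. Vinnikov, *Determinantal representations of
singular hypersurfaces in ℙⁿ*, Adv. Math. 231 (2012), arXiv:0906.3012, §3 Thm. 3.1), Part 1 of the
printed proof: "any entry of `ℳ^∨` at any point belongs to the local ideal `⟨f₁, f₂⟩` … Noether's
`AF + BG` theorem … hence `ℳ^∨ = f₂ 𝒩₁ + f₁ 𝒩₂`".  We replace the general `AF + BG` theorem
(saturatedness of a complete-intersection ideal) by an elementary special case for TWO coprime
forms, proved here from scratch: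

* homogeneity bookkeeping (degree arguments, homogeneity of determinants / adjugates of matrices
  of forms; the component formula for a product with a form is taken from
  `Literature.AlgebraicGeometry.Resolution.AdicNoetherian`);
* the SATURATION ENGINE (`mem_span_pair_of_pow_mul_mem_of_isRelPrime`): over a domain, if two
  "coordinate-like" elements `ℓ, ℓ'` (each killed by a ring endomorphism that is the identity
  modulo it, the substitutions `x_j ↦ c x_{i₀}`) satisfy `ℓᴺ G, ℓ'ᴷ G ∈ (f₁, f₂)` with `f₁, f₂`
  coprime and `f₁` not vanishing identically on `{ℓ = ℓ' = 0}`, then `G ∈ (f₁, f₂)` — this is the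
  statement `depth k[x]/(f₁, f₂) ≥ 1` for `n ≥ 2`, made explicit;
* the Nullstellensatz step (`exists_pow_mul_mem_of_forall_point`): local membership at every
  point `a ≠ 0` of `kⁿ⁺¹` gives `ℓᴺ G ∈ I` for every polynomial `ℓ` vanishing at the origin;
* the case `n = 1` (binary forms), where `(f₁, f₂)` is irrelevant and one needs instead
  Sylvester's dimension count: every binary form of degree `d₁ + d₂ - 1` lies in `(f₁, f₂)`
  (`binaryForm_mem_span_pair`); and the vacuity of the case `n = 0`.

## References

* [KernerVinnikov2012] D. Kerner, V. Vinnikov, Adv. Math. 231 (2012) 1619–1654, §3.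
* E. Arbarello, M. Cornalba, P. Griffiths, J. Harris, Geometry of Algebraic Curves I (Noether's
  `AF + BG` theorem), the reference `[ACGH-book]` of the printed proof.
-/

noncomputable section

open MvPolynomial Matrix

namespace Literature.AlgebraicGeometry.DeterminantalHypersurfaces

/-! ## Homogeneity bookkeeping -/

section homogeneous

variable {σ : Type*} {S : Type*} [CommRing S] [IsDomain S]

/-- A nonzero form of degree `p` divides no nonzero form of degree `< p`. [folklore] -/
theorem eq_zero_of_dvd_of_isHomogeneous_lt {f y : MvPolynomial σ S} {p q : ℕ}
    (hf : f.IsHomogeneous p) (hf0 : f ≠ 0) (hy : y.IsHomogeneous q) (hqp : q < p) (hdvd : f ∣ y) :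
    y = 0 := by
  classical
  obtain ⟨h, rfl⟩ := hdvd
  suffices hh : ∀ e, homogeneousComponent e h = 0 by
    rw [← sum_homogeneousComponent h, Finset.sum_eq_zero (fun e _ => hh e), mul_zero]
  intro e
  have h1 : homogeneousComponent (p + e) (f * h) = f * homogeneousComponent e h := by
    rw [mul_comm f h, Resolution.homogeneousComponent_mul_of_isHomogeneous h f (p + e) hf,
      if_pos (Nat.le_add_right p e), Nat.add_sub_cancel_left, mul_comm]
  have h2 : homogeneousComponent (p + e) (f * h) = 0 := by
    rw [homogeneousComponent_of_mem hy, if_neg (by omega)]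
  rw [h2] at h1
  exact (mul_eq_zero.mp h1.symm).resolve_left hf0

/-- If `f ≠ 0` and `f · a` are forms of the same degree then `a` is a constant. [folklore] -/
theorem eq_C_of_isHomogeneous_mul_self {f a : MvPolynomial σ S} {p : ℕ}
    (hf : f.IsHomogeneous p) (hf0 : f ≠ 0) (hfa : (f * a).IsHomogeneous p) :
    a = C (coeff 0 a) := by
  classical
  have hcomp : ∀ e, e ≠ 0 → homogeneousComponent e a = 0 := by
    intro e he
    have h1 : homogeneousComponent (p + e) (f * a) = f * homogeneousComponent e a := by
      rw [mul_comm f a, Resolution.homogeneousComponent_mul_of_isHomogeneous a f (p + e) hf,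
        if_pos (Nat.le_add_right p e), Nat.add_sub_cancel_left, mul_comm]
    have h2 : homogeneousComponent (p + e) (f * a) = 0 := by
      rw [homogeneousComponent_of_mem hfa, if_neg (by omega)]
    rw [h2] at h1
    exact (mul_eq_zero.mp h1.symm).resolve_left hf0
  conv_lhs => rw [← sum_homogeneousComponent a]
  rw [Finset.sum_eq_single 0 (fun e _ he => hcomp e he) (fun h => absurd (by simp) h),
    homogeneousComponent_zero]

omit [IsDomain S] in
/-- The determinant of a square matrix of forms whose `i`-th row consists of forms of degree
`r i` is a form of degree `∑ i, r i`. [folklore] -/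
theorem isHomogeneous_det_of_rows {ι : Type*} [Fintype ι] [DecidableEq ι]
    {X : Matrix ι ι (MvPolynomial σ S)} {r : ι → ℕ}
    (h : ∀ i j, (X i j).IsHomogeneous (r i)) : X.det.IsHomogeneous (∑ i, r i) := by
  rw [Matrix.det_apply]
  refine IsHomogeneous.sum _ _ _ fun τ _ => ?_
  have hp : (∏ i, X (τ i) i).IsHomogeneous (∑ i, r i) := by
    have := IsHomogeneous.prod Finset.univ (fun i => X (τ i) i) (fun i => r (τ i))
      (fun i _ => h _ _)
    rwa [Equiv.sum_comp τ r] at this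
  rw [Units.smul_def]
  exact (mem_homogeneousSubmodule _ _).mp
    (zsmul_mem ((mem_homogeneousSubmodule _ _).mpr hp) _)

omit [IsDomain S] in
/-- The determinant of a square matrix of linear forms is a form of degree the size of the
matrix. [folklore] -/
theorem isHomogeneous_det_of_linear {ι : Type*} [Fintype ι] [DecidableEq ι]
    {X : Matrix ι ι (MvPolynomial σ S)} (h : ∀ i j, (X i j).IsHomogeneous 1) :
    X.det.IsHomogeneous (Fintype.card ι) := by
  have := isHomogeneous_det_of_rows (r := fun _ => 1) h
  simpa using this

omit [IsDomain S] in
/-- The adjugate of a square matrix of linear forms consists of forms of degree `size - 1`.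
[folklore] -/
theorem isHomogeneous_adjugate_of_linear {ι : Type*} [Fintype ι] [DecidableEq ι]
    {X : Matrix ι ι (MvPolynomial σ S)} (h : ∀ i j, (X i j).IsHomogeneous 1) (i j : ι) :
    (X.adjugate i j).IsHomogeneous (Fintype.card ι - 1) := by
  rw [Matrix.adjugate_apply]
  have hsum : ∑ l, Function.update (fun _ : ι => 1) j 0 l = Fintype.card ι - 1 := by
    rw [Finset.sum_update_of_mem (Finset.mem_univ j), zero_add, Finset.sum_const, smul_eq_mul,
      mul_one, Finset.card_univ_sdiff, Finset.card_singleton]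
  rw [← hsum]
  refine isHomogeneous_det_of_rows fun i' j' => ?_
  rw [Matrix.updateRow_apply]
  by_cases hi' : i' = j
  · subst hi'
    rw [if_pos rfl, Function.update_self, Pi.single_apply]
    split_ifs
    · exact isHomogeneous_one σ S
    · exact isHomogeneous_zero σ S 0
  · rw [if_neg hi', Function.update_of_ne hi']
    exact h i' j'

end homogeneous

/-! ## The saturation engine (an elementary case of Noether's `AF + BG`) -/

section engine

variable {R : Type*} [CommRing R] [IsDomain R]

/-- If `τ` kills `ℓ` and is the identity modulo `ℓ`, then `ℓ ∣ g y` forces `ℓ ∣ y` as soon as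
`τ g ≠ 0`. [folklore] -/
theorem dvd_of_dvd_mul_of_map_ne_zero {τ : R →+* R} {ℓ g : R} (hτℓ : τ ℓ = 0)
    (hτ : ∀ m, ℓ ∣ m - τ m) (hg : τ g ≠ 0) {y : R} (h : ℓ ∣ g * y) : ℓ ∣ y := by
  obtain ⟨z, hz⟩ := h
  have h1 : τ g * τ y = 0 := by
    have := congrArg τ hz
    rwa [map_mul, map_mul, hτℓ, zero_mul] at this
  have hy : τ y = 0 := (mul_eq_zero.mp h1).resolve_left hg
  simpa [hy] using hτ y

/-- `g ∣ ℓᴺ h ⇒ g ∣ h` when `g` does not vanish identically on `{ℓ = 0}` (`τ g ≠ 0` for the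
substitution `τ` killing `ℓ`). [folklore] -/
theorem dvd_of_dvd_pow_mul_of_map_ne_zero {τ : R →+* R} {ℓ g : R} (hℓ0 : ℓ ≠ 0) (hτℓ : τ ℓ = 0)
    (hτ : ∀ m, ℓ ∣ m - τ m) (hg : τ g ≠ 0) :
    ∀ (N : ℕ) (h : R), g ∣ ℓ ^ N * h → g ∣ h := by
  intro N
  induction N with
  | zero => intro h hh; simpa using hh
  | succ N ih =>
    intro h ⟨m, hm⟩
    have h1 : τ g * τ m = 0 := by
      have := congrArg τ hm
      rw [map_mul, map_mul, map_pow, hτℓ, zero_pow (Nat.succ_ne_zero N), zero_mul] at this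
      exact this.symm
    have hm0 : τ m = 0 := (mul_eq_zero.mp h1).resolve_left hg
    obtain ⟨m', hm'⟩ : ℓ ∣ m := by simpa [hm0] using hτ m
    refine ih h ⟨m', mul_left_cancel₀ hℓ0 ?_⟩
    rw [← mul_assoc, ← pow_succ', hm, hm']
    ring

/-- The key permutation step: `ℓ'ᴷ h ∈ (g, ℓᴺ) ⇒ h ∈ (g, ℓᴺ)`, i.e. `ℓ'` is a non-zero-divisor
modulo `(g, ℓᴺ)`, given substitutions `τ, τ'` killing `ℓ, ℓ'` with `τ' (τ g) ≠ 0` (so `g` does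
not vanish identically on `{ℓ = ℓ' = 0}`). [folklore] -/
theorem mem_span_pair_pow_of_pow_mul_mem {τ τ' : R →+* R} {ℓ ℓ' g : R}
    (hℓ0 : ℓ ≠ 0) (hτℓ : τ ℓ = 0) (hτ : ∀ m, ℓ ∣ m - τ m) (hg : τ g ≠ 0)
    (hℓ'0 : ℓ' ≠ 0) (hτ'ℓ' : τ' ℓ' = 0) (hτ' : ∀ m, ℓ' ∣ m - τ' m) (hg' : τ' (τ g) ≠ 0)
    (hτℓ' : τ ℓ' = ℓ') (K : ℕ) :
    ∀ (N : ℕ) (h : R), ℓ' ^ K * h ∈ Ideal.span {g, ℓ ^ N} → h ∈ Ideal.span {g, ℓ ^ N} := by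
  intro N
  induction N with
  | zero =>
    intro h _
    exact Ideal.mem_span_pair.mpr ⟨0, h, by ring⟩
  | succ N ih =>
    intro h hh
    obtain ⟨α, β, hαβ⟩ := Ideal.mem_span_pair.mp hh
    -- apply `τ`: `τ α · τ g = ℓ'ᴷ · τ h`
    have h1 : τ α * τ g = ℓ' ^ K * τ h := by
      have := congrArg τ hαβ
      rw [map_add, map_mul, map_mul, map_mul, map_pow, map_pow, hτℓ, hτℓ',
        zero_pow (Nat.succ_ne_zero N), mul_zero, add_zero] at this
      exact this
    -- hence `τ g ∣ τ h`
    obtain ⟨t, ht⟩ : τ g ∣ τ h :=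
      dvd_of_dvd_pow_mul_of_map_ne_zero hℓ'0 hτ'ℓ' hτ' hg' K (τ h) ⟨τ α, by rw [← h1]; ring⟩
    -- write `h = g t + ℓ h₂`
    obtain ⟨h₁, hh₁⟩ := hτ h
    obtain ⟨w, hw⟩ := hτ g
    have hdec : h = g * t + ℓ * (h₁ - w * t) := by
      have : h = τ h + ℓ * h₁ := by rw [← hh₁]; ring
      rw [this, ht, show τ g = g - ℓ * w by rw [← hw]; ring]
      ring
    set h₂ := h₁ - w * t with hh₂
    -- substitute back: `ℓ (ℓ'ᴷ h₂ - β ℓᴺ) = g (α - ℓ'ᴷ t)`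
    have h2 : g * (α - ℓ' ^ K * t) = ℓ * (ℓ' ^ K * h₂ - β * ℓ ^ N) := by
      have := hαβ
      rw [hdec] at this
      linear_combination this
    obtain ⟨α₁, hα₁⟩ : ℓ ∣ α - ℓ' ^ K * t :=
      dvd_of_dvd_mul_of_map_ne_zero hτℓ hτ hg ⟨_, h2⟩
    have h3 : ℓ' ^ K * h₂ = α₁ * g + β * ℓ ^ N := by
      have : ℓ * (ℓ' ^ K * h₂ - β * ℓ ^ N) = ℓ * (α₁ * g) := by rw [← h2, hα₁]; ring
      have := mul_left_cancel₀ hℓ0 this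
      linear_combination this
    have h4 : h₂ ∈ Ideal.span {g, ℓ ^ N} := ih h₂ (Ideal.mem_span_pair.mpr ⟨α₁, β, h3.symm⟩)
    obtain ⟨γ, δ, hγδ⟩ := Ideal.mem_span_pair.mp h4
    exact Ideal.mem_span_pair.mpr ⟨t + ℓ * γ, δ, by rw [hdec, ← hγδ]; ring⟩

/-- THE SATURATION ENGINE. With `ℓ, ℓ', τ, τ'` as above, `f₁ = g` not vanishing identically on
`{ℓ = ℓ' = 0}` and `f₁, f₂` coprime: `ℓᴺ G ∈ (f₁, f₂)` and `ℓ'ᴷ G ∈ (f₁, f₂)` imply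
`G ∈ (f₁, f₂)`. (For `k[x₀, …, xₙ]`, `n ≥ 2`, this is the case `k = 2` of Noether's `AF + BG`
theorem used in [KernerVinnikov2012, §3, proof of Thm. 3.1]: a form lying in `(f₁, f₂)` locally at
every point of `ℙⁿ` lies in `(f₁, f₂)`.) [folklore] -/
theorem mem_span_pair_of_pow_mul_mem_of_isRelPrime [DecompositionMonoid R]
    {τ τ' : R →+* R} {ℓ ℓ' g f₂ : R}
    (hℓ0 : ℓ ≠ 0) (hτℓ : τ ℓ = 0) (hτ : ∀ m, ℓ ∣ m - τ m) (hg : τ g ≠ 0)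
    (hℓ'0 : ℓ' ≠ 0) (hτ'ℓ' : τ' ℓ' = 0) (hτ' : ∀ m, ℓ' ∣ m - τ' m) (hg' : τ' (τ g) ≠ 0)
    (hτℓ' : τ ℓ' = ℓ') (hcop : IsRelPrime g f₂) {G : R} {N K : ℕ}
    (hN : ℓ ^ N * G ∈ Ideal.span {g, f₂}) (hK : ℓ' ^ K * G ∈ Ideal.span {g, f₂}) :
    G ∈ Ideal.span {g, f₂} := by
  obtain ⟨p, q, hpq⟩ := Ideal.mem_span_pair.mp hN
  obtain ⟨p', q', hpq'⟩ := Ideal.mem_span_pair.mp hK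
  -- `(ℓ'ᴷ q - ℓᴺ q') f₂ = (ℓᴺ p' - ℓ'ᴷ p) g`
  have h1 : (ℓ' ^ K * q - ℓ ^ N * q') * f₂ = (ℓ ^ N * p' - ℓ' ^ K * p) * g := by
    linear_combination (ℓ' ^ K) * hpq - (ℓ ^ N) * hpq'
  obtain ⟨w, hw⟩ : g ∣ ℓ' ^ K * q - ℓ ^ N * q' :=
    hcop.dvd_of_dvd_mul_right ⟨ℓ ^ N * p' - ℓ' ^ K * p, by rw [h1]; ring⟩
  have h2 : ℓ' ^ K * q ∈ Ideal.span {g, ℓ ^ N} :=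
    Ideal.mem_span_pair.mpr ⟨w, q', by rw [← sub_add_cancel (ℓ' ^ K * q) (ℓ ^ N * q'), hw]; ring⟩
  obtain ⟨c, t, hct⟩ := Ideal.mem_span_pair.mp
    (mem_span_pair_pow_of_pow_mul_mem hℓ0 hτℓ hτ hg hℓ'0 hτ'ℓ' hτ' hg' hτℓ' K N q h2)
  -- `ℓᴺ (G - t f₂) = (p + c f₂) g`
  have h3 : g ∣ ℓ ^ N * (G - t * f₂) := ⟨p + c * f₂, by rw [mul_sub, ← hpq, ← hct]; ring⟩
  obtain ⟨u, hu⟩ := dvd_of_dvd_pow_mul_of_map_ne_zero hℓ0 hτℓ hτ hg N _ h3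
  exact Ideal.mem_span_pair.mpr ⟨u, t, by rw [← sub_add_cancel G (t * f₂), hu]; ring⟩

end engine

/-! ## The engine in `k[x]`: substitutions `x_j ↦ c · x_{i₀}` -/

section substitution

variable {σ : Type*} [DecidableEq σ] {k : Type*} [Field k]

/-- The substitution `x_j ↦ F_j` is the identity modulo `x_j - F_j` (here `F_j = c x_{i₀}`).
[folklore] -/
theorem X_sub_dvd_sub_aeval_update (j i₀ : σ) (c : k) (m : MvPolynomial σ k) :
    (X j - C c * X i₀) ∣ m - aeval (Function.update X j (C c * X i₀)) m := by
  induction m using MvPolynomial.induction_on with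
  | C a => simp
  | add p q hp hq =>
    have : p + q - aeval (Function.update X j (C c * X i₀)) (p + q) =
        (p - aeval (Function.update X j (C c * X i₀)) p) +
          (q - aeval (Function.update X j (C c * X i₀)) q) := by
      rw [map_add]; ring
    rw [this]
    exact dvd_add hp hq
  | mul_X p i hp =>
    have : p * X i - aeval (Function.update X j (C c * X i₀)) (p * X i) =
        (p - aeval (Function.update X j (C c * X i₀)) p) * X i +
          aeval (Function.update X j (C c * X i₀)) p *
            (X i - Function.update X j (C c * X i₀) i) := by
      rw [map_mul, aeval_X]; ring
    rw [this]
    refine dvd_add (dvd_mul_of_dvd_left hp _) (dvd_mul_of_dvd_right ?_ _)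
    by_cases hi : i = j
    · subst hi
      simp
    · simp [Function.update_of_ne hi]

/-- The substitution `x_j ↦ c x_{i₀}` kills `x_j - c x_{i₀}` (`j ≠ i₀`). [folklore] -/
theorem aeval_update_X_sub_C_mul_X {j i₀ : σ} (hj : j ≠ i₀) (c : k) :
    aeval (Function.update X j (C c * X i₀)) (X j - C c * X i₀ : MvPolynomial σ k) = 0 := by
  simp [Function.update_of_ne hj.symm]

/-- The substitution `x_j ↦ c x_{i₀}` fixes `x_{j'} - c' x_{i₀}` (`j' ≠ j`, `i₀ ≠ j`). [folklore] -/
theorem aeval_update_X_sub_C_mul_X' {j j' i₀ : σ} (hj : j ≠ i₀) (hjj' : j ≠ j') (c c' : k) :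
    aeval (Function.update X j (C c * X i₀)) (X j' - C c' * X i₀ : MvPolynomial σ k) =
      X j' - C c' * X i₀ := by
  simp [Function.update_of_ne hj.symm, Function.update_of_ne (Ne.symm hjj')]

/-- `x_j - c x_{i₀} ≠ 0` (`j ≠ i₀`). [folklore] -/
theorem X_sub_C_mul_X_ne_zero {j i₀ : σ} (hj : j ≠ i₀) (c : k) :
    (X j - C c * X i₀ : MvPolynomial σ k) ≠ 0 := by
  intro h
  have := congrArg (eval (Pi.single j (1 : k))) h
  simp [hj.symm] at this

/-- Evaluation at `b` is unchanged by the substitution `x_j ↦ (b_j / b_{i₀}) x_{i₀}`. [folklore] -/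
theorem eval_aeval_update_eq {j i₀ : σ} (b : σ → k) (hb : b i₀ ≠ 0)
    (m : MvPolynomial σ k) :
    eval b (aeval (Function.update X j (C (b j / b i₀) * X i₀)) m) = eval b m := by
  have : (eval b).comp (aeval (Function.update X j (C (b j / b i₀) * X i₀))).toRingHom =
      eval b := by
    refine MvPolynomial.ringHom_ext (fun r => by simp) (fun i => ?_)
    by_cases hi : i = j
    · subst hi
      simp [div_mul_cancel₀ _ hb]
    · simp [Function.update_of_ne hi]
  exact RingHom.congr_fun this m

/-- **Saturation in `k[x]` (elementary case of Noether's `AF + BG`).** Let `f₁, f₂ ∈ k[x_σ]` be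
coprime and let `b` be a point with `f₁(b) ≠ 0`, `b_{i₀} ≠ 0`; let `j ≠ j'` be two further
indices. If `(x_j - (b_j/b_{i₀}) x_{i₀})ᴺ G` and `(x_{j'} - (b_{j'}/b_{i₀}) x_{i₀})ᴷ G` lie in
`(f₁, f₂)` then so does `G`. [folklore] -/
theorem mem_span_pair_of_pow_linear_mul_mem {i₀ j j' : σ} (hj : j ≠ i₀) (hj' : j' ≠ i₀)
    (hjj' : j ≠ j') {b : σ → k} (hb : b i₀ ≠ 0) {f₁ f₂ G : MvPolynomial σ k}
    (hf₁ : eval b f₁ ≠ 0) (hcop : IsRelPrime f₁ f₂) {N K : ℕ}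
    (hN : (X j - C (b j / b i₀) * X i₀) ^ N * G ∈ Ideal.span {f₁, f₂})
    (hK : (X j' - C (b j' / b i₀) * X i₀) ^ K * G ∈ Ideal.span {f₁, f₂}) :
    G ∈ Ideal.span {f₁, f₂} := by
  set τ : MvPolynomial σ k →+* MvPolynomial σ k :=
    (aeval (Function.update X j (C (b j / b i₀) * X i₀))).toRingHom with hτ
  set τ' : MvPolynomial σ k →+* MvPolynomial σ k :=
    (aeval (Function.update X j' (C (b j' / b i₀) * X i₀))).toRingHom with hτ'
  have hτf₁ : τ f₁ ≠ 0 := by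
    intro h
    apply hf₁
    rw [← eval_aeval_update_eq (j := j) b hb f₁]
    change eval b (τ f₁) = 0
    rw [h, map_zero]
  have hτ'f₁ : τ' (τ f₁) ≠ 0 := by
    intro h
    apply hf₁
    rw [← eval_aeval_update_eq (j := j) b hb f₁, ← eval_aeval_update_eq (j := j') b hb]
    change eval b (τ' (τ f₁)) = 0
    rw [h, map_zero]
  exact mem_span_pair_of_pow_mul_mem_of_isRelPrime (τ := τ) (τ' := τ')
    (X_sub_C_mul_X_ne_zero hj _) (aeval_update_X_sub_C_mul_X hj _)
    (X_sub_dvd_sub_aeval_update j i₀ _) hτf₁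
    (X_sub_C_mul_X_ne_zero hj' _) (aeval_update_X_sub_C_mul_X hj' _)
    (X_sub_dvd_sub_aeval_update j' i₀ _) hτ'f₁
    (aeval_update_X_sub_C_mul_X' hj hjj' _ _) hcop hN hK

end substitution

/-! ## From points to powers: the Nullstellensatz step -/

section nullstellensatz

variable {σ : Type*} [Finite σ] {k : Type*} [Field k] [IsAlgClosed k]

/-- If `G` lies in `I` locally at every point `a ≠ 0` of `k^σ` (i.e. `s G ∈ I` for some `s` with
`s(a) ≠ 0`), then for every polynomial `ℓ` vanishing at the origin some power `ℓᴺ` multiplies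
`G` into `I` (Hilbert's Nullstellensatz applied to the ideal quotient `(I : G)`, whose zero locus
is contained in `{0}`). [folklore] -/
theorem exists_pow_mul_mem_of_forall_point (I : Ideal (MvPolynomial σ k)) (G ℓ : MvPolynomial σ k)
    (hℓ : eval 0 ℓ = 0)
    (hloc : ∀ a : σ → k, a ≠ 0 → ∃ s : MvPolynomial σ k, eval a s ≠ 0 ∧ s * G ∈ I) :
    ∃ N : ℕ, ℓ ^ N * G ∈ I := by
  set J : Ideal (MvPolynomial σ k) := Submodule.colon I {G} with hJ
  have hℓJ : ℓ ∈ vanishingIdeal k (zeroLocus k J) := by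
    rw [mem_vanishingIdeal_iff]
    intro a ha
    rw [mem_zeroLocus_iff] at ha
    by_cases ha0 : a = 0
    · subst ha0
      simpa [coe_aeval_eq_eval] using hℓ
    · obtain ⟨s, hs, hsG⟩ := hloc a ha0
      have hsJ : s ∈ J := Submodule.mem_colon_singleton.mpr (by simpa [smul_eq_mul] using hsG)
      have := ha s hsJ
      exact absurd (by simpa [coe_aeval_eq_eval] using this) hs
  rw [vanishingIdeal_zeroLocus_eq_radical] at hℓJ
  obtain ⟨N, hN⟩ := hℓJ
  exact ⟨N, by simpa [smul_eq_mul] using (Submodule.mem_colon_singleton.mp hN)⟩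

end nullstellensatz

/-! ## Binary forms (`n = 1`): Sylvester's dimension count; and the vacuous case `n = 0` -/

section binary

variable {k : Type*} [Field k]

/-- The binary forms of degree `m` form a `k`-space of dimension `m + 1`. [folklore] -/
theorem finrank_homogeneousSubmodule_fin_two (m : ℕ) :
    Module.finrank k (homogeneousSubmodule (Fin 2) k m) = m + 1 := by
  -- the exponent vectors of degree `m` in two variables are `(i, m - i)`, `0 ≤ i ≤ m`
  let E : ↥({d : Fin 2 →₀ ℕ | d.degree = m}) ≃ Fin (m + 1) :=
    { toFun := fun d => ⟨d.1 0, by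
        have h := d.2
        simp only [Set.mem_setOf_eq, Finsupp.degree_eq_sum, Fin.sum_univ_two] at h
        omega⟩
      invFun := fun i => ⟨Finsupp.single 0 i.1 + Finsupp.single 1 (m - i.1), by
        have hi : i.1 ≤ m := Nat.lt_succ_iff.mp i.2
        simp only [Set.mem_setOf_eq, map_add, Finsupp.degree_single]
        omega⟩
      left_inv := fun d => by
        have h := d.2
        simp only [Set.mem_setOf_eq, Finsupp.degree_eq_sum, Fin.sum_univ_two] at h
        apply Subtype.ext
        ext a
        fin_cases a
        · simp
        · simp only [Fin.mk_one, Finsupp.coe_add, Pi.add_apply]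
          rw [Finsupp.single_eq_of_ne (by decide), Finsupp.single_eq_same]
          omega
      right_inv := fun i => by
        ext
        simp }
  letI : Fintype ↥({d : Fin 2 →₀ ℕ | d.degree = m}) := Fintype.ofEquiv (Fin (m + 1)) E.symm
  rw [homogeneousSubmodule_eq_finsupp_supported,
    LinearEquiv.finrank_eq (AddMonoidAlgebra.supportedEquivFinsupp _),
    Module.finrank_finsupp_self, Fintype.ofEquiv_card, Fintype.card_fin]

/-- **Sylvester (binary forms).** For coprime binary forms `f₁ ≠ 0`, `f₂` of degrees
`d₁, d₂ ≥ 1`, every binary form of degree `d₁ + d₂ - 1` lies in the ideal `(f₁, f₂)`: the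
Sylvester map `(A, B) ↦ A f₁ + B f₂`, `deg A = d₂ - 1`, `deg B = d₁ - 1`, is injective between
spaces of the same dimension `d₁ + d₂`. (Replaces Noether's `AF + BG` in the case `n = 1` of
[KernerVinnikov2012, Thm. 3.1], where `X₁ ∩ X₂ = ∅`.) [folklore] -/
theorem binaryForm_mem_span_pair {d₁ d₂ : ℕ} (hd₁ : 0 < d₁) (hd₂ : 0 < d₂)
    {f₁ f₂ : MvPolynomial (Fin 2) k} (h₁ : f₁.IsHomogeneous d₁) (h₂ : f₂.IsHomogeneous d₂)
    (hf₁ : f₁ ≠ 0) (hcop : IsRelPrime f₁ f₂)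
    {G : MvPolynomial (Fin 2) k} (hG : G.IsHomogeneous (d₁ + d₂ - 1)) :
    G ∈ Ideal.span {f₁, f₂} := by
  have hfin : ∀ m, Module.Finite k (homogeneousSubmodule (Fin 2) k m) := fun m =>
    Module.Finite.iff_fg.mpr (homogeneousSubmodule_fg (Fin 2) k m)
  haveI := hfin (d₂ - 1)
  haveI := hfin (d₁ - 1)
  haveI := hfin (d₁ + d₂ - 1)
  -- the Sylvester map
  let Φ₀ : (homogeneousSubmodule (Fin 2) k (d₂ - 1) × homogeneousSubmodule (Fin 2) k (d₁ - 1)) →ₗ[k]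
      MvPolynomial (Fin 2) k :=
    (LinearMap.mulRight k f₁ ∘ₗ (homogeneousSubmodule (Fin 2) k (d₂ - 1)).subtype).coprod
      (LinearMap.mulRight k f₂ ∘ₗ (homogeneousSubmodule (Fin 2) k (d₁ - 1)).subtype)
  have hΦ₀ : ∀ c, Φ₀ c = c.1.1 * f₁ + c.2.1 * f₂ := fun c => by
    simp [Φ₀]
  have hΦ₀mem : ∀ c, Φ₀ c ∈ homogeneousSubmodule (Fin 2) k (d₁ + d₂ - 1) := by
    intro c
    rw [hΦ₀, mem_homogeneousSubmodule]
    have e1 : d₂ - 1 + d₁ = d₁ + d₂ - 1 := by omega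
    have e2 : d₁ - 1 + d₂ = d₁ + d₂ - 1 := by omega
    exact (e1 ▸ (c.1.2 : (c.1.1).IsHomogeneous (d₂ - 1)).mul h₁).add (e2 ▸ (c.2.2 :
      (c.2.1).IsHomogeneous (d₁ - 1)).mul h₂)
  let Φ := Φ₀.codRestrict (homogeneousSubmodule (Fin 2) k (d₁ + d₂ - 1)) hΦ₀mem
  -- injectivity: `A f₁ + B f₂ = 0 ⇒ f₁ ∣ B ⇒ B = 0` by degrees
  have hinj : Function.Injective Φ := by
    rw [injective_iff_map_eq_zero]
    rintro ⟨⟨A, hA⟩, ⟨B, hB⟩⟩ hc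
    have hc' : A * f₁ + B * f₂ = 0 := by
      have := congrArg Subtype.val hc
      simpa [Φ, hΦ₀] using this
    have hBdvd : f₁ ∣ B :=
      hcop.dvd_of_dvd_mul_right ⟨-A, by linear_combination hc'⟩
    have hB0 : B = 0 :=
      eq_zero_of_dvd_of_isHomogeneous_lt h₁ hf₁ hB (by omega) hBdvd
    have hA0 : A = 0 := by
      rw [hB0, zero_mul, add_zero] at hc'
      exact (mul_eq_zero.mp hc').resolve_right hf₁
    subst hA0 hB0
    rfl
  have hdim : Module.finrank k
      (homogeneousSubmodule (Fin 2) k (d₂ - 1) × homogeneousSubmodule (Fin 2) k (d₁ - 1)) =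
        Module.finrank k (homogeneousSubmodule (Fin 2) k (d₁ + d₂ - 1)) := by
    rw [Module.finrank_prod, finrank_homogeneousSubmodule_fin_two,
      finrank_homogeneousSubmodule_fin_two, finrank_homogeneousSubmodule_fin_two]
    omega
  have hsurj : Function.Surjective Φ :=
    (LinearMap.injective_iff_surjective_of_finrank_eq_finrank hdim).mp hinj
  obtain ⟨c, hc⟩ := hsurj ⟨G, (mem_homogeneousSubmodule _ _).mpr hG⟩
  have : c.1.1 * f₁ + c.2.1 * f₂ = G := by
    have := congrArg Subtype.val hc
    simpa [Φ, hΦ₀] using this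
  exact Ideal.mem_span_pair.mpr ⟨c.1.1, c.2.1, this⟩

/-- In one variable, `x₀` divides every form of positive degree. [folklore] -/
theorem X_dvd_of_isHomogeneous_fin_one {d : ℕ} (f : MvPolynomial (Fin 1) k) (hf : f.IsHomogeneous d)
    (hd : 0 < d) : (X 0 : MvPolynomial (Fin 1) k) ∣ f := by
  rw [f.as_sum]
  refine Finset.dvd_sum fun s hs => ?_
  rw [X_dvd_monomial]
  refine Or.inr fun hs0 => ?_
  have h1 := hf.degree_eq_sum_deg_support hs
  have : s = 0 := by
    refine Finsupp.ext fun a => ?_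
    fin_cases a
    simpa using hs0
  rw [this] at h1
  simp at h1
  omega

/-- The case `n = 0` of [KernerVinnikov2012, Thm. 3.1] is vacuous: two forms of positive degree
in ONE variable are never coprime. [folklore] -/
theorem not_isRelPrime_of_isHomogeneous_fin_one {d₁ d₂ : ℕ} (hd₁ : 0 < d₁) (hd₂ : 0 < d₂)
    {f₁ f₂ : MvPolynomial (Fin 1) k} (h₁ : f₁.IsHomogeneous d₁) (h₂ : f₂.IsHomogeneous d₂) :
    ¬ IsRelPrime f₁ f₂ := by
  intro h
  have hu : IsUnit (X 0 : MvPolynomial (Fin 1) k) :=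
    h (X_dvd_of_isHomogeneous_fin_one f₁ h₁ hd₁) (X_dvd_of_isHomogeneous_fin_one f₂ h₂ hd₂)
  have := hu.map (eval (0 : Fin 1 → k))
  simp at this

end binary

end Literature.AlgebraicGeometry.DeterminantalHypersurfaces
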